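import Literature.NumberTheory.Automorphic.HilbertRepSpectrum
import Mathlib.Analysis.CStarAlgebra.ContinuousFunctionalCalculus.Basic
import Mathlib.Analysis.CStarAlgebra.ContinuousFunctionalCalculus.Commute
import Mathlib.Analysis.CStarAlgebra.ContinuousLinearMap
import Mathlib.Analysis.InnerProductSpace.Adjoint
import HarnessLib

/-!
# Schur's lemma for topologically irreducible operator families and unitary representations

Trunk `AutomorphicAxiomatic` (G19), topic `NumberTheory/Automorphic`; sibling of
`HilbertRepSpectrum` (closed subrepresentations `ClosedSubrep`, topological irreducibility
`ContRepresentation.IsTopIrreducible`, unitarity `ContRepresentation.IsUnitary`).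

**Schur's lemma** in the form of Deitmar–Echterhoff, *Principles of Harmonic Analysis* (2014),
Thm. 5.1.6, (a) ⇒ (b): *if a set `𝒮 ⊆ 𝓑(H)` of bounded operators on a complex Hilbert space is
self-adjoint (`S ∈ 𝒮 ⇒ S* ∈ 𝒮`) and topologically irreducible (every closed `𝒮`-invariant
subspace is `0` or `H`), then every bounded operator commuting with `𝒮` is a scalar `μ • Id`*
(`Literature.NumberTheory.Automorphic.IsIrreducibleFamily.exists_eq_algebraMap`), and its consequence for representations
(op. cit. Lemma 6.1.7, (a) ⇒ (b)): *a bounded operator commuting with a topologically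
irreducible unitary representation is a scalar*
(`ContRepresentation.IsTopIrreducible.exists_eq_algebraMap_of_commute`, pointwise form
`exists_apply_eq_smul_of_commute`). Everything here is proved.

## The proof (op. cit., proof of Thm. 5.1.6)

Self-adjoint case (`exists_eq_algebraMap_of_isSelfAdjoint`), by Mathlib's continuous
functional calculus on the C⋆-algebra `H →L[ℂ] H` (`cfc` over `ℝ` for self-adjoint elements):
if the real spectrum of `A` contained `a < b`, the continuous functions `f = (m - ·)⁺` and
`g = (· - m)⁺` (`m` the midpoint) have `f g = 0`, so `g(A) f(A) = (g f)(A) = 0` (`cfc_mul`)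
while `f(A) ≠ 0 ≠ g(A)` (spectral mapping `cfc_map_spectrum`: `f(a) ≠ 0` lies in the spectrum
of `f(A)`); `ker g(A)` is closed and `𝒮`-invariant (what commutes with `A` commutes with
`g(A)`, `Commute.cfc_real`), non-zero (it contains the range of `f(A)`) and proper — against
irreducibility. So the spectrum lies in a singleton `{c}` and `A = c • Id`
(`CFC.eq_algebraMap_of_spectrum_subset_singleton`, i.e. op. cit. Lemma 5.1.5). General case:
`T*` commutes with `𝒮` too (adjoints of `S* T = T S*`), hence so do `ℜ T`, `ℑ T`
(Mathlib `realPart`, `imaginaryPart`), and `T = ℜ T + i ℑ T`. For a unitary representation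
`π` the family `{π g}` is self-adjoint because `(π g)* = π g⁻¹` (`IsUnitary.adjoint_apply`),
and a closed `{π g}`-invariant subspace is a `ClosedSubrep`.

## Design notes

* `Literature.IsIrreducibleFamily 𝒮` is stated for a bare set of operators (no algebra structure), so
  that it applies both to `Set.range π` and to mixed families (Hecke operators together with a
  group action on a space of fixed vectors, as in the Gelfand-pair argument of op. cit.
  Thm. 11.2.4 (b)).
* Scalars are expressed as `algebraMap ℂ (H →L[ℂ] H) c` (`= c • 1`; Mathlib
  `ContinuousLinearMap.algebraMap_apply` evaluates it to `c • v`).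

## References

* A. Deitmar, S. Echterhoff, *Principles of Harmonic Analysis*, 2nd ed., Universitext (2014),
  Lemma 5.1.5, Thm. 5.1.6, Lemma 6.1.7, Thm. 11.2.4 [DeitmarEchterhoff2014].
-/

noncomputable section

open scoped InnerProductSpace ComplexStarModule
open Topology

namespace Literature.NumberTheory.Automorphic

section OperatorFamily

variable {H : Type*} [NormedAddCommGroup H] [InnerProductSpace ℂ H] [CompleteSpace H]

/-- A set `𝒮` of bounded operators on `H` acts *topologically irreducibly* if every closed
subspace of `H` invariant under all members of `𝒮` is `⊥` or `⊤`. [folklore] -/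
def IsIrreducibleFamily (𝒮 : Set (H →L[ℂ] H)) : Prop :=
  ∀ W : Submodule ℂ H, IsClosed (W : Set H) → (∀ S ∈ 𝒮, ∀ v ∈ W, S v ∈ W) → W = ⊥ ∨ W = ⊤

omit [CompleteSpace H] in
/-- A bounded operator on a non-trivial space which is zero has real spectrum `{0}`; so an
operator whose real spectrum contains a non-zero point is non-zero. [folklore] -/
theorem ne_zero_of_mem_spectrum {T : H →L[ℂ] H} {x : ℝ} (hx : x ∈ spectrum ℝ T) (hx0 : x ≠ 0) :
    T ≠ 0 := by
  rintro rfl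
  have hnt : Nontrivial (H →L[ℂ] H) := by
    by_contra h
    rw [not_nontrivial_iff_subsingleton] at h
    simp [spectrum.of_subsingleton] at hx
  rw [spectrum.zero_eq, Set.mem_singleton_iff] at hx
  exact hx0 hx

/-- **Schur's lemma, self-adjoint case.** A self-adjoint bounded operator commuting with a
topologically irreducible family of operators on a complex Hilbert space is a real scalar.
Proof via the continuous functional calculus: if the (real) spectrum of `A` contained two points
`a < b`, the continuous functions `f = (m - ·)⁺`, `g = (· - m)⁺` (`m` the midpoint) satisfy
`f g = 0`, so `f(A) g(A) = 0` with `f(A), g(A) ≠ 0` (spectral mapping); `ker g(A)` is then a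
closed invariant subspace (everything commuting with `A` commutes with `g(A)`) which is neither
`⊥` (it contains the range of `f(A)`) nor `⊤`. Hence the spectrum is at most a singleton and
`A` is the corresponding scalar (Deitmar–Echterhoff (2014), proof of Thm. 5.1.6, with Lemma 5.1.5).
[cite: DeitmarEchterhoff2014, Thm. 5.1.6] -/
theorem IsIrreducibleFamily.exists_eq_algebraMap_of_isSelfAdjoint {𝒮 : Set (H →L[ℂ] H)}
    (h𝒮 : IsIrreducibleFamily 𝒮) {A : H →L[ℂ] H} (hA : IsSelfAdjoint A)
    (hcomm : ∀ S ∈ 𝒮, Commute S A) : ∃ c : ℝ, A = algebraMap ℝ (H →L[ℂ] H) c := by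
  -- the real spectrum of `A` is a subsingleton
  have hsub : (spectrum ℝ A).Subsingleton := by
    intro a ha b hb
    by_contra hab
    wlog hlt : a < b generalizing a b
    · exact this hb ha (Ne.symm hab) (lt_of_le_of_ne (not_lt.mp hlt) (Ne.symm hab))
    set m : ℝ := (a + b) / 2 with hm
    set f : ℝ → ℝ := fun x => max (m - x) 0 with hf
    set g : ℝ → ℝ := fun x => max (x - m) 0 with hg
    have hfc : Continuous f := by fun_prop
    have hgc : Continuous g := by fun_prop
    have hfg : f * g = 0 := by
      ext x
      simp only [Pi.mul_apply, Pi.zero_apply, hf, hg]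
      rcases le_total x m with h | h
      · rw [max_eq_right (by linarith : x - m ≤ 0), mul_zero]
      · rw [max_eq_right (by linarith : m - x ≤ 0), zero_mul]
    have hfa : f a ≠ 0 := by
      simp only [hf, hm]; rw [max_eq_left (by linarith)]; linarith
    have hgb : g b ≠ 0 := by
      simp only [hg, hm]; rw [max_eq_left (by linarith)]; linarith
    -- `f(A) g(A) = 0`, both non-zero, both commuting with `𝒮`
    have hgf : (fun x => g x * f x) = 0 := by
      funext x
      have := congrFun hfg x
      simpa [mul_comm] using this
    have hprod : cfc g A * cfc f A = 0 := by
      rw [← cfc_mul g f A, hgf, cfc_zero]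
    have hfA : cfc f A ≠ 0 := by
      refine ne_zero_of_mem_spectrum (x := f a) ?_ hfa
      rw [cfc_map_spectrum f A]
      exact ⟨a, ha, rfl⟩
    have hgA : cfc g A ≠ 0 := by
      refine ne_zero_of_mem_spectrum (x := g b) ?_ hgb
      rw [cfc_map_spectrum g A]
      exact ⟨b, hb, rfl⟩
    -- the closed invariant subspace `ker g(A)`
    set W : Submodule ℂ H := LinearMap.ker ((cfc g A : H →L[ℂ] H) : H →ₗ[ℂ] H) with hW
    have hWc : IsClosed (W : Set H) := ContinuousLinearMap.isClosed_ker (cfc g A)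
    have hmemW : ∀ v : H, v ∈ W ↔ cfc g A v = 0 := fun v => Iff.rfl
    have hWinv : ∀ S ∈ 𝒮, ∀ v ∈ W, S v ∈ W := by
      intro S hS v hv
      have hc : Commute (cfc g A) S := (hcomm S hS).symm.cfc_real g
      rw [hmemW] at hv ⊢
      change (cfc g A * S) v = 0
      rw [hc.eq]
      change S (cfc g A v) = 0
      rw [hv, map_zero]
    rcases h𝒮 W hWc hWinv with hbot | htop
    · -- `range f(A) ⊆ W = ⊥` forces `f(A) = 0`
      apply hfA
      ext v
      have hv : cfc f A v ∈ W := by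
        rw [hmemW]
        change (cfc g A * cfc f A) v = 0
        rw [hprod]
        rfl
      rw [hbot, Submodule.mem_bot] at hv
      rw [hv]
      rfl
    · -- `W = ⊤` forces `g(A) = 0`
      apply hgA
      ext v
      have hv : v ∈ W := by rw [htop]; exact Submodule.mem_top
      rw [hmemW] at hv
      rw [hv]
      rfl
  -- hence contained in a singleton
  obtain ⟨c, hc⟩ : ∃ c : ℝ, spectrum ℝ A ⊆ {c} := by
    rcases (spectrum ℝ A).eq_empty_or_nonempty with h | ⟨c, hc⟩
    · exact ⟨0, by simp [h]⟩
    · exact ⟨c, fun x hx => hsub hx hc⟩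
  exact ⟨c, CFC.eq_algebraMap_of_spectrum_subset_singleton A c hc hA⟩

/-- **Schur's lemma for irreducible self-adjoint operator families** (Deitmar–Echterhoff (2014),
Thm. 5.1.6, (a) ⇒ (b)): if a set `𝒮` of bounded operators on a complex Hilbert space is
closed under adjoints and acts topologically irreducibly, every bounded operator commuting with
`𝒮` is a scalar. Reduction to the self-adjoint case: `T* ` also commutes with `𝒮` (adjoints
of the relations `S* T = T S*`, `S* ∈ 𝒮`), hence so do the real and imaginary parts
`ℜ T = (T + T*)/2`, `ℑ T = (T - T*)/2i`, which are scalars by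
`exists_eq_algebraMap_of_isSelfAdjoint`, and `T = ℜ T + i ℑ T`.
[cite: DeitmarEchterhoff2014, Thm. 5.1.6] -/
theorem IsIrreducibleFamily.exists_eq_algebraMap {𝒮 : Set (H →L[ℂ] H)}
    (h𝒮 : IsIrreducibleFamily 𝒮) (hstar : ∀ S ∈ 𝒮, ContinuousLinearMap.adjoint S ∈ 𝒮)
    {T : H →L[ℂ] H} (hcomm : ∀ S ∈ 𝒮, Commute S T) :
    ∃ c : ℂ, T = algebraMap ℂ (H →L[ℂ] H) c := by
  have hcomm' : ∀ S ∈ 𝒮, Commute S (star T) := by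
    intro S hS
    have h := hcomm _ (hstar S hS)
    rw [← commute_star_star, ContinuousLinearMap.star_eq_adjoint,
      ContinuousLinearMap.adjoint_adjoint] at h
    exact h
  have hre : ∀ S ∈ 𝒮, Commute S (ℜ T : H →L[ℂ] H) := by
    intro S hS
    rw [realPart_apply_coe]
    exact ((hcomm S hS).add_right (hcomm' S hS)).smul_right _
  have him : ∀ S ∈ 𝒮, Commute S (ℑ T : H →L[ℂ] H) := by
    intro S hS
    rw [imaginaryPart_apply_coe]
    exact (((hcomm S hS).sub_right (hcomm' S hS)).smul_right _).smul_right _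
  obtain ⟨a, ha⟩ := h𝒮.exists_eq_algebraMap_of_isSelfAdjoint (ℜ T).2 hre
  obtain ⟨b, hb⟩ := h𝒮.exists_eq_algebraMap_of_isSelfAdjoint (ℑ T).2 him
  refine ⟨a + Complex.I * b, ?_⟩
  rw [← realPart_add_I_smul_imaginaryPart T, ha, hb, map_add, map_mul,
    IsScalarTower.algebraMap_apply ℝ ℂ (H →L[ℂ] H) a,
    IsScalarTower.algebraMap_apply ℝ ℂ (H →L[ℂ] H) b, Algebra.smul_def, Complex.coe_algebraMap,
    Algebra.algebraMap_eq_smul_one Complex.I]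

end OperatorFamily

end Literature.NumberTheory.Automorphic

namespace ContRepresentation

/-! ### Schur's lemma for topologically irreducible unitary representations -/

section Unitary

variable {G H : Type*} [Group G] [NormedAddCommGroup H] [InnerProductSpace ℂ H] [CompleteSpace H]
  {π : ContRepresentation ℂ G H}

omit [CompleteSpace H] in
/-- The operators of a topologically irreducible representation form an irreducible family:
a closed subspace invariant under every `π g` is a closed subrepresentation. [folklore] -/
theorem IsTopIrreducible.isIrreducibleFamily_range (hirr : π.IsTopIrreducible) :
    Literature.NumberTheory.Automorphic.IsIrreducibleFamily (Set.range fun g : G => (π g : H →L[ℂ] H)) := by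
  intro W hWc hWinv
  let W' : ClosedSubrep π :=
    { toSubmodule := W
      apply_mem_toSubmodule := fun g v hv => hWinv _ ⟨g, rfl⟩ v hv
      isClosed' := hWc }
  rcases ((isTopIrreducible_iff π).mp hirr).2 W' with h | h
  · left
    have := congrArg (fun W : ClosedSubrep π => W.toSubmodule) h
    simpa [W', ClosedSubrep.toSubmodule_bot] using this
  · right
    have := congrArg (fun W : ClosedSubrep π => W.toSubmodule) h
    simpa [W', ClosedSubrep.toSubmodule_top] using this

/-- **Schur's lemma** (Deitmar–Echterhoff (2014), Lemma 6.1.7, (a) ⇒ (b)): every bounded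
operator commuting with a topologically irreducible *unitary* representation `π` of a group `G`
on a complex Hilbert space is a scalar, `T = c • 1`. Unitarity makes the family `{π g}` closed
under adjoints (`(π g)* = π g⁻¹`), so Thm. 5.1.6 (`Literature.NumberTheory.Automorphic.IsIrreducibleFamily.exists_eq_algebraMap`)
applies. [cite: DeitmarEchterhoff2014, Lemma 6.1.7] -/
theorem IsTopIrreducible.exists_eq_algebraMap_of_commute (hirr : π.IsTopIrreducible)
    (hπ : π.IsUnitary) {T : H →L[ℂ] H} (hT : ∀ g : G, Commute (π g : H →L[ℂ] H) T) :
    ∃ c : ℂ, T = algebraMap ℂ (H →L[ℂ] H) c := by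
  refine hirr.isIrreducibleFamily_range.exists_eq_algebraMap ?_ ?_
  · rintro _ ⟨g, rfl⟩
    exact ⟨g⁻¹, (hπ.adjoint_apply g).symm⟩
  · rintro _ ⟨g, rfl⟩
    exact hT g

/-- **Schur's lemma, pointwise form**: under the hypotheses of
`exists_eq_algebraMap_of_commute`, `T v = c • v` for one scalar `c` and all `v`.
[cite: DeitmarEchterhoff2014, Lemma 6.1.7] -/
theorem IsTopIrreducible.exists_apply_eq_smul_of_commute (hirr : π.IsTopIrreducible)
    (hπ : π.IsUnitary) {T : H →L[ℂ] H} (hT : ∀ g : G, Commute (π g : H →L[ℂ] H) T) :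
    ∃ c : ℂ, ∀ v : H, T v = c • v := by
  obtain ⟨c, hc⟩ := hirr.exists_eq_algebraMap_of_commute hπ hT
  exact ⟨c, fun v => by rw [hc, ContinuousLinearMap.algebraMap_apply]⟩

end Unitary

end ContRepresentation
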